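/-
Copyright: the b2b-balaban cell (near-miss cell 7), T⁴-continuum fan-out, lineage t4-ne7b-p1 (node U5c COUNT member).
Released under the licence of the surrounding project.
-/
import Summits.QuantumFields.BalabanUV.T4Continuum.Support.CountThresholdUniform

/-!
# A witness run and a witness genealogy for the count chain (non-vacuity, part 1)

Summits-side support leaf of the T⁴-continuum cell (rung (B)+1 on a FINITE torus only; NOT infinite volume, NOT the
mass gap, NOT the Clay statement; NOT a proof of the spine estimate NE7b).  Lineage `t4-ne7b-p1` (generation 21),
node U5c.  [folklore] MODEL data over the lineage's OWN typed carrier; nothing is quoted from print, nothing printed is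
asserted, nothing of Bałaban's is constructed; no `[cite:]` tag.

PURPOSE.  The row's exit (`CountThresholdUniform.relWeightBoundZ_of_irThreshold`, the named-threshold form of
`PartnerMultiplicityThreshold.exists_irThreshold_relWeightBoundZ_threshold`) carries some thirty binders accumulated over
generations 11–20 (typed flow families, event tables, cells, labelled prices with multiplicity, live families, two
`Regeneration` runs).  This leaf and its companion `Support/CountWitness` inhabit ALL of them AT ONCE by explicit model
data with a NON-EMPTY, POSITIVELY WEIGHTED bad class — so the exit statement is neither contradictory nor trivially
satisfied.  (With the landed ∃-form this could not be written down: its threshold is produced after the term families;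
with the named threshold the coupling is chosen AFTER the threshold, as in the intended use.)

THIS PART.  §1 the witness constants `Cw` (`n₁ = 1`, `dC = 0`, `q′ = 1`, `E₂ = E₃ = E₀ = Eb = μ = a = A₀ = 1`, `κ₁ = 8`,
`p₀ = 3`; `L = 2`, `r = 1`, `β₀ = 0`) and `thresholdOK_w`.  §2 the witness RUN: the infrared value
`xw := max (irThresholdZ Cw 1 1 (1∕2) 1 1 2 1 0) 1`, the constant coupling `gw = e^{−xw∕2}` (`log gw⁻² = xw`), the
window `Rw = 2^{sw}` with `sw` the LEAST exponent with `xw ≤ 2^{sw}` (so `B14.IsRj 2 1 gw Rw`), and the typed flow facts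
(2.7)∕(2.9) for the constant run with `β′ = β₀ = 0`.  §3 the witness GENEALOGY: two births `b₀ = (0,0,0)`,
`b₁ = (1,0,0)`, their merger `em = (2,2,0)` at step `2`, then renewals AT READINESS, `chain m` = `m` renewals; reach,
root, events, merges, births, partner ages computed; `Consistent`∕`WF` proved; `mK K` = the least number of renewals
that keeps the structure pending at the cutoff `K` (`Nat.find`), `GK K := chain (mK K)`.

HONEST DEPENDENCY (cell): continuum YM on T⁴ ⇐ BetaPertH ∧ nine spine estimates (0/9 proved); BetaPertH ⇐ (D1) ∧ (D4)
∧ CAP+tail.  This file changes none of it.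
-/

open Finset
open Literature.MathematicalPhysics.QuantumFieldTheory.Balaban1983to89
open T4PersistenceDictionary T4PersistentHistoryCount T4BankedInduction T4PrintedShapeBanking
open T4PartnerMultiplicity
open Summit.QuantumFields.BalabanUV.T4Continuum.PlacementBatch
open Summit.QuantumFields.BalabanUV.T4Continuum.PlacementSkeleton
open Summit.QuantumFields.BalabanUV.T4Continuum.Crowding
open Summit.QuantumFields.BalabanUV.T4Continuum.CountThresholdUniform

namespace Summit.QuantumFields.BalabanUV.T4Continuum.CountWitnessRun

noncomputable section

/-! ## §1 The witness constants -/

/-- The witness constants: merger allowance `n₁ = 1`, connector class `dC = 0`, floor power `q′ = 1`, every real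
constant `1` except the bank rate `κ₁ = 8`, profile exponent `p₀ = 3`. [folklore] -/
def Cw : T4PrintedShapeBanking.Consts where
  n₁ := 1
  dC := 0
  q' := 1
  E₂ := 1
  E₃ := 1
  κ₁ := 8
  E₀ := 1
  Eb := 1
  μ := 1
  a := 1
  A₀ := 1
  p₀ := 3

/-- the witness constants are valid (`fatWait dC = 1 ≤ n₁ = 1`) [folklore] -/
theorem Cw_valid : Cw.Valid where
  E₂_nonneg := by simp [Cw]
  E₃_nonneg := by simp [Cw]
  κ₁_nonneg := by simp [Cw]
  E₀_nonneg := by simp [Cw]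
  Eb_nonneg := by simp [Cw]
  μ_nonneg := by simp [Cw]
  dC_le := by simp [Cw, fatWait]

/-- the side conditions of the threshold hold for the witness constants with `L = 2`, `r = 1`, `β₀ = 0`
(`r(q′+1) = 2 < 3 = p₀`). [folklore] -/
theorem thresholdOK_w : ThresholdOK Cw 2 1 0 where
  valid := Cw_valid
  a_pos := by simp [Cw]
  A₀_pos := by simp [Cw]
  one_le_L := by norm_num
  β₀_nonneg := le_rfl
  rq_lt := by simp [Cw]

/-! ## §2 The witness run: infrared value above the named threshold, constant coupling, least admissible window -/

/-- the infrared value: the named zone-crowding threshold of the witness constants (zone constants `Kz = 1`, `p = 1`,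
`σ = 1∕2`, `ε = 1`, `θ = 1`), raised to at least `1` [folklore] -/
def xw : ℝ := max (irThresholdZ Cw 1 1 (1 / 2) 1 1 2 1 0) 1

/-- `1 ≤ xw` [folklore] -/
theorem one_le_xw : 1 ≤ xw := le_max_right _ _

/-- the threshold is below the infrared value [folklore] -/
theorem irThresholdZ_le_xw : irThresholdZ Cw 1 1 (1 / 2) 1 1 2 1 0 ≤ xw := le_max_left _ _

/-- `0 < xw` [folklore] -/
theorem xw_pos : 0 < xw := lt_of_lt_of_le one_pos one_le_xw

/-- the constant coupling `gw = e^{−xw∕2}` [folklore] -/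
def gw : ℝ := Real.exp (-(xw / 2))

/-- `log gw⁻² = xw` [folklore] -/
theorem log_gw : Real.log ((gw ^ 2)⁻¹) = xw := by
  have : gw ^ 2 = Real.exp (-xw) := by
    rw [gw, sq, ← Real.exp_add]; ring_nf
  rw [this, ← Real.exp_neg, neg_neg, Real.log_exp]

/-- powers of two exceed the infrared value eventually [folklore] -/
theorem exists_pow_ge : ∃ s : ℕ, xw ≤ (2 : ℝ) ^ s := by
  obtain ⟨n, hn⟩ := exists_nat_gt xw
  refine ⟨n, hn.le.trans ?_⟩
  exact_mod_cast Nat.lt_two_pow_self.le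

open Classical in
/-- the least exponent `sw` with `xw ≤ 2^{sw}` [folklore] -/
def sw : ℕ := Nat.find exists_pow_ge

/-- the witness window `Rw = 2^{sw}` [folklore] -/
def Rw : ℕ := 2 ^ sw

open Classical in
/-- `xw ≤ Rw` [folklore] -/
theorem xw_le_Rw : xw ≤ (Rw : ℝ) := by
  have h := Nat.find_spec exists_pow_ge
  rw [Rw]; push_cast; exact h

open Classical in
/-- minimality of the exponent [folklore] -/
theorem sw_le_of_le {s' : ℕ} (h : xw ≤ (2 : ℝ) ^ s') : sw ≤ s' := Nat.find_min' exists_pow_ge h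

/-- `1 ≤ Rw` [folklore] -/
theorem one_le_Rw : 1 ≤ Rw := Nat.one_le_two_pow

/-- **(2.5) for the witness run**: `Rw` is the least power of `L = 2` above `(log gw⁻²)^1`. [folklore] -/
theorem isRj_w : B14.IsRj 2 1 gw Rw := by
  refine ⟨sw, rfl, ?_, fun s' hs' => sw_le_of_le ?_⟩
  · rw [pow_one, log_gw]; exact xw_le_Rw
  · rw [pow_one, log_gw] at hs'
    simpa using hs'

/-- **(2.7) for the constant run** (`β′ = 0`, `β₀ = 0`): both members are equalities. [folklore] -/
theorem flowIneq27_w (p K : ℕ) : B14.FlowIneq27 (fun _ => gw) 0 0 p K := by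
  intro m n _ _
  simp

/-- **(2.9) for the constant run** (`L = 2`, `β′ = 0`, `β₀ = 0`): `Rw ≤ 2·Rw`. [folklore] -/
theorem flowIneq29_w (K : ℕ) : B14FlowStep.FlowIneq29 (fun _ => Rw) (fun _ => gw) 2 0 0 K := by
  intro m n _ _
  have h0 : (0 : ℝ) ≤ Rw := Nat.cast_nonneg _
  constructor
  · push_cast; linarith
  · simp only [Real.rpow_zero, mul_one]; push_cast; linarith

/-- `1 ≤ log gw⁻²` [folklore] -/
theorem one_le_log_gw : 1 ≤ Real.log ((gw ^ 2)⁻¹) := by rw [log_gw]; exact one_le_xw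

/-- the infrared smallness at the NAMED threshold [folklore] -/
theorem ir_w : irThresholdZ Cw 1 1 (1 / 2) 1 1 2 1 0 ≤ Real.log ((gw ^ 2)⁻¹) := by rw [log_gw]; exact irThresholdZ_le_xw

/-- the profile at the witness coupling is at least `1` (`A₀ = 1`, `xw ≥ 1`) [folklore] -/
theorem one_le_p0Profile_w : 1 ≤ p0Profile Cw.A₀ Cw.p₀ gw := by
  rw [p0Profile, log_gw]
  simp only [Cw, one_mul]
  exact one_le_pow₀ one_le_xw

/-- the profile at the witness coupling is nonnegative [folklore] -/
theorem p0Profile_w_nonneg : 0 ≤ p0Profile Cw.A₀ Cw.p₀ gw := zero_le_one.trans one_le_p0Profile_w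

/-! ## §3 The witness genealogy: two births, one merger, renewals at readiness -/

/-- the window table of the witness run [folklore] -/
def Ww : PEv → ℕ := dictW (fun _ => Rw) Cw.n₁

/-- the root birth `(0, 0, 0)` (step `0`, kind birth, fatness `0`) [folklore] -/
def b₀ : PEv := (0, 0, 0)
/-- the second birth `(1, 0, 0)` [folklore] -/
def b₁ : PEv := (1, 0, 0)
/-- the merger event `(2, 2, 0)` [folklore] -/
def em : PEv := (2, 2, 0)
/-- the renewal event at step `t` [folklore] -/
def er (t : ℕ) : PEv := (t, 1, 0)

/-- window of the root birth: `fatWait 0 + Rw + 1 = Rw + 2` [folklore] -/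
@[simp] theorem Ww_b₀ : Ww b₀ = Rw + 2 := by simp [Ww, b₀, Cw, fatWait]; omega
/-- window of the second birth [folklore] -/
@[simp] theorem Ww_b₁ : Ww b₁ = Rw + 2 := by simp [Ww, b₁, Cw, fatWait]; omega
/-- window of the merger: `n₁ + Rw = Rw + 1` [folklore] -/
@[simp] theorem Ww_em : Ww em = Rw + 1 := by simp [Ww, em, Cw]; omega
/-- window of a renewal: `Rw + 1` [folklore] -/
@[simp] theorem Ww_er (t : ℕ) : Ww (er t) = Rw + 1 := by simp [Ww, er, Cw]

/-- the merged pair `merge (born b₀ 0) (born b₁ 1) em` [folklore] -/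
def M₀ : Gen PEv := Gen.merge (Gen.born b₀ 0) (Gen.born b₁ 1) em

/-- **THE WITNESS CHAIN**: `chain m` = the merged pair renewed `m` times, each renewal AT READINESS (at the step equal
to the current reach). [folklore] -/
def chain : ℕ → Gen PEv
  | 0 => M₀
  | m + 1 => Gen.renew (chain m) (er ((chain m).reach Ww)) ((chain m).reach Ww - 1)

/-- the reach after `m` renewals: `2Rw + 4 + m(Rw + 1)` [folklore] -/
theorem reach_chain : ∀ m : ℕ, (chain m).reach Ww = 2 * Rw + 4 + m * (Rw + 1)
  | 0 => by simp [chain, M₀, Gen.reach]; omega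
  | m + 1 => by
      have h := reach_chain m
      simp only [chain, Gen.reach_renew, Ww_er, h, Nat.add_mul, one_mul]
      omega

/-- abbreviation: the reach sequence `ρ m = 2Rw + 4 + m(Rw + 1)` [folklore] -/
def ρ (m : ℕ) : ℕ := 2 * Rw + 4 + m * (Rw + 1)

/-- `reach (chain m) = ρ m` [folklore] -/
theorem reach_chain_eq (m : ℕ) : (chain m).reach Ww = ρ m := reach_chain m

/-- the reach sequence is strictly increasing [folklore] -/
theorem ρ_lt_succ (m : ℕ) : ρ m < ρ (m + 1) := by
  simp only [ρ, Nat.add_mul, one_mul]; omega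

/-- the reach sequence is monotone [folklore] -/
theorem ρ_mono {i m : ℕ} (h : i ≤ m) : ρ i ≤ ρ m := by
  have := Nat.mul_le_mul_right (Rw + 1) h
  simp only [ρ]; omega

/-- `3 ≤ ρ m` [folklore] -/
theorem three_le_ρ (m : ℕ) : 3 ≤ ρ m := by simp [ρ]; omega

/-- the root step is `0` [folklore] -/
@[simp] theorem rootStep_chain : ∀ m : ℕ, (chain m).rootStep = 0
  | 0 => by simp [chain, M₀, Gen.rootStep]
  | m + 1 => by simp [chain, rootStep_chain m]

/-- the root is `b₀` [folklore] -/
@[simp] theorem root_chain : ∀ m : ℕ, (chain m).root = b₀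
  | 0 => by simp [chain, M₀, Gen.root, Gen.rootStep]
  | m + 1 => by simp [chain, root_chain m]

/-- the mergers: exactly `em` [folklore] -/
@[simp] theorem merges_chain : ∀ m : ℕ, merges (chain m) = {em}
  | 0 => by simp [chain, M₀, merges]
  | m + 1 => by simp [chain, merges, merges_chain m]

/-- the births: `b₀` and `b₁` [folklore] -/
@[simp] theorem births_chain : ∀ m : ℕ, births (chain m) = {b₀, b₁}
  | 0 => by simp [chain, M₀, births]
  | m + 1 => by simp [chain, births_chain m]

/-- the partner ages: `2 + 1 − max 0 1 = 2` [folklore] -/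
@[simp] theorem partnerAges_chain : ∀ m : ℕ, partnerAges PEv.step (chain m) = 2
  | 0 => by simp [chain, M₀, partnerAges, Gen.rootStep, em]
  | m + 1 => by simp [chain, partnerAges_chain m]

/-- the events: the three base events and the renewals at the reaches `ρ i`, `i < m` [folklore] -/
theorem events_chain : ∀ m : ℕ, (chain m).events = {em, b₀, b₁} ∪ (range m).image fun i => er (ρ i)
  | 0 => by simp [chain, M₀, Gen.events]
  | m + 1 => by
      rw [chain, Gen.events_renew, events_chain m, reach_chain_eq, Finset.range_add_one, image_insert]
      ext e; simp only [mem_insert, mem_union, mem_image, mem_range]; tauto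

/-- the kinds of the base events [folklore] -/
theorem kind_b₀ : b₀.kind = 0 := rfl
/-- … [folklore] -/
theorem kind_b₁ : b₁.kind = 0 := rfl
/-- … [folklore] -/
theorem kind_em : em.kind = 2 := rfl
/-- … [folklore] -/
theorem kind_er (t : ℕ) : (er t).kind = 1 := rfl
/-- steps of the base events [folklore] -/
theorem step_er (t : ℕ) : (er t).step = t := rfl

/-- a renewal event of the chain sits at a reach `ρ i` with `i < m`; the base events are not renewals [folklore] -/
theorem step_lt_of_mem {m : ℕ} {e : PEv} (he : e ∈ (chain m).events) (hk : e.kind = 1) : e.step < ρ m := by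
  rw [events_chain] at he
  simp only [mem_union, mem_insert, mem_singleton, mem_image, mem_range] at he
  rcases he with (rfl | rfl | rfl) | ⟨i, hi, rfl⟩
  · simp [em, PEv.kind] at hk
  · simp [b₀, PEv.kind] at hk
  · simp [b₁, PEv.kind] at hk
  · rw [step_er]; exact lt_of_lt_of_le (ρ_lt_succ i) (ρ_mono (Nat.succ_le_of_lt hi))

/-- the next renewal event is fresh [folklore] -/
theorem er_notMem (m : ℕ) : er (ρ m) ∉ (chain m).events := fun h =>
  (lt_irrefl (ρ m)) (by simpa [step_er] using step_lt_of_mem h (kind_er _))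

/-- **WELL-FORMEDNESS** of the witness chain: fresh events, renewal inside the pending life, merger partners alive
together (`0 < Rw + 3`, `1 < Rw + 2`). [folklore] -/
theorem wf_chain : ∀ m : ℕ, (chain m).WF Ww
  | 0 => by
      simp only [chain, M₀, Gen.WF, Gen.events_born, mem_singleton, disjoint_singleton, Gen.rootStep_born,
        Gen.reach_born, Ww_b₀, Ww_b₁, true_and]
      refine ⟨by decide, by decide, by decide, by omega, by omega⟩
  | m + 1 => by
      simp only [chain, Gen.WF]
      refine ⟨wf_chain m, ?_, by simp, ?_⟩
      · rw [reach_chain_eq]; exact er_notMem m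
      · have := three_le_ρ m; rw [reach_chain_eq]; omega

/-- **CONSISTENCY** of the witness chain at a cutoff `K ≥ 2` reached by no renewal yet performed: births of kind `0` at
their steps `0, 1 ≤ K`, the merger of kind `2` at step `2` inside both partners' lives, every renewal of kind `1` AT
READINESS and at a step `≤ K`. [folklore] -/
theorem consistent_chain {K : ℕ} (hK : 2 ≤ K) : ∀ {m : ℕ}, (∀ i < m, ρ i ≤ K) → Consistent Cw K (fun _ => Rw) (chain m)
  | 0, _ => by
      have h1 := one_le_Rw
      simp only [chain, M₀, Consistent, Gen.rootStep_born, Gen.reach_born]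
      refine ⟨⟨rfl, rfl, by omega⟩, ⟨rfl, rfl, by omega⟩, rfl, by simp [em], ?_, by simp [em], ?_, by
        simp [em]; omega⟩
      · show em.step < 0 + dictW (fun _ => Rw) Cw.n₁ b₀
        have : dictW (fun _ => Rw) Cw.n₁ b₀ = Rw + 2 := Ww_b₀
        rw [this]; simp [em]; omega
      · show em.step < 1 + dictW (fun _ => Rw) Cw.n₁ b₁
        have : dictW (fun _ => Rw) Cw.n₁ b₁ = Rw + 2 := Ww_b₁
        rw [this]; simp [em]; omega
  | m + 1, h => by
      have hm : ∀ i < m, ρ i ≤ K := fun i hi => h i (Nat.lt_succ_of_lt hi)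
      have hρ : ρ m ≤ K := h m (Nat.lt_succ_self m)
      have h3 := three_le_ρ m
      have hW : (chain m).reach Ww = ρ m := reach_chain_eq m
      have hD : (chain m).reach (dictW (fun _ => Rw) Cw.n₁) = ρ m := reach_chain_eq m
      simp only [chain, Consistent, hW, hD]
      refine ⟨consistent_chain hK hm, rfl, ?_, ?_, ?_⟩
      · rw [step_er]; omega
      · omega
      · omega

/-- the reaches are unbounded: some renewal count keeps the structure pending at any cutoff [folklore] -/
theorem exists_pending (K : ℕ) : ∃ m : ℕ, K < ρ m := ⟨K, by simp [ρ]; nlinarith [one_le_Rw]⟩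

open Classical in
/-- **THE RENEWAL COUNT AT CUTOFF `K`**: the least `m` with `K < ρ m` (all earlier reaches are `≤ K`, so every performed
renewal is at a step `≤ K`). [folklore] -/
def mK (K : ℕ) : ℕ := Nat.find (exists_pending K)

open Classical in
/-- the structure with `mK K` renewals is pending at `K` [folklore] -/
theorem lt_ρ_mK (K : ℕ) : K < ρ (mK K) := Nat.find_spec (exists_pending K)

open Classical in
/-- every performed renewal is at a step `≤ K` [folklore] -/
theorem ρ_le_of_lt_mK {K i : ℕ} (hi : i < mK K) : ρ i ≤ K := by
  have := Nat.find_min (exists_pending K) hi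
  omega

/-- **THE WITNESS GENEALOGY AT CUTOFF `K`** [folklore] -/
def GK (K : ℕ) : Gen PEv := chain (mK K)

/-- it is well formed [folklore] -/
theorem wf_GK (K : ℕ) : (GK K).WF Ww := wf_chain _

/-- it is consistent at every cutoff `K ≥ 2` [folklore] -/
theorem consistent_GK {K : ℕ} (hK : 2 ≤ K) : Consistent Cw K (fun _ => Rw) (GK K) :=
  consistent_chain hK fun _ hi => ρ_le_of_lt_mK hi

/-- it is pending at `K` [folklore] -/
theorem lt_reach_GK (K : ℕ) : K < (GK K).reach Ww := by rw [GK, reach_chain_eq]; exact lt_ρ_mK K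

/-- its root step is `0`, its root is `b₀` [folklore] -/
theorem rootStep_GK (K : ℕ) : (GK K).rootStep = 0 := rootStep_chain _
/-- … [folklore] -/
theorem root_GK (K : ℕ) : (GK K).root = b₀ := root_chain _
/-- its mergers, births, partner ages [folklore] -/
theorem merges_GK (K : ℕ) : merges (GK K) = {em} := merges_chain _
/-- … [folklore] -/
theorem births_GK (K : ℕ) : births (GK K) = {b₀, b₁} := births_chain _
/-- … [folklore] -/
theorem partnerAges_GK (K : ℕ) : partnerAges PEv.step (GK K) = 2 := partnerAges_chain _

/-- every non-root event of the witness genealogy sits at a step in `(0, K]` and has fatness `0` [folklore] -/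
theorem mem_events_GK {K : ℕ} (hK : 2 ≤ K) {e : PEv} (he : e ∈ (GK K).events) (hne : e ≠ b₀) :
    e.step ∈ Ioc 0 K ∧ e.fat = 0 := by
  rw [GK, events_chain] at he
  simp only [mem_union, mem_insert, mem_singleton, mem_image, mem_range] at he
  rcases he with (rfl | rfl | rfl) | ⟨i, hi, rfl⟩
  · exact ⟨by simp [em, PEv.step]; omega, rfl⟩
  · exact absurd rfl hne
  · exact ⟨by simp [b₁, PEv.step]; omega, rfl⟩
  · refine ⟨?_, rfl⟩
    have h1 := ρ_le_of_lt_mK hi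
    have h3 := three_le_ρ i
    simp [er, PEv.step]; omega

/-! ## §4 Sanity -/

namespace Sanity

/-- consecutive reaches differ by the renewal window `Rw + 1`; the merger is a merger of every stage [folklore] -/
example (m : ℕ) : ρ (m + 1) = ρ m + (Rw + 1) ∧ em ∈ merges (chain m) := by
  refine ⟨?_, by simp⟩
  simp only [ρ, Nat.add_mul, one_mul]; omega

end Sanity

end

end Summit.QuantumFields.BalabanUV.T4Continuum.CountWitnessRun
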